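/-
Copyright (c) 2026 the pub-hodgecm-mathlib formalisation cell (harness21).  Prover seat hodgecm-mathlib-K2Liu-p11 (g5), Track B «K2-LIT», #184♮ = hLiu418 =
`stmt-HodgeConjecture-24832`; socket #41, KIND W, THE (iii-arch) BLOCK LETTER OF RECORD `hBL_of_record` (LEAD F0P6-plan (g15) BATCH #252, 2026-09-05T02:05:36Z).
THEOREMS ONLY (no `def`, no `instance`, no notation, no named-fact hypothesis, no `sorry`, default heartbeats).
-/
import Summits.HodgeConjecture.HodgeConjecture.Theorems.K2LiuKindWArchBlockLetterOfPlaceGrowth        -- ★ p864379 (3c) part 2 `hBL_of_placeGrowth` (this seat)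
import Summits.HodgeConjecture.HodgeConjecture.Theorems.K2LiuKindWArchGrowthFaceOfRecord              -- ★ p864208 `hWgrU_of_record`
import Summits.HodgeConjecture.HodgeConjecture.Theorems.K2LiuKindWArchGrowthStabUniformSigns        -- ★ (3d-iv) §C `stabUniform_posDef∕negDef∕indef` (brings §B, the at-one heads, (R3))
import Summits.HodgeConjecture.HodgeConjecture.Theorems.K2LiuKindWArchWhittakerHolomorphy           -- ★ p864042 `hWhol_of_std`
import Summits.HodgeConjecture.HodgeConjecture.Theorems.K2LiuKindWArchContinuationExplicitOfRecord    -- ★ p864207 (L1) `exists_frames_archWhittakerIntegral_eq_of_std`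
import Summits.HodgeConjecture.HodgeConjecture.Theorems.K2LiuHolTubeRigidityOfFrame                   -- ★ `frame_mem`, `frame_mul`, `frame_archPart_weylDelta`
import HarnessLib

/-!
# Crux `HLiu418`, socket #41, KIND W — `K2LiuKindWArchBlockLetterOfRecord`: THE (iii-arch) BLOCK LETTER `hBL` OF RECORD, ZERO RESIDUE

Cell `hodgecm-mathlib`, hLiu418 = `stmt-HodgeConjecture-24832` (helper lane, count-neutral), route of record `HCCMUnconditional`; squad K2 ∕ K2Liu, socket #41, KIND W.
THE HEAD `hBL_of_record` ⊢ ★ p863724 `kindW_block_cm_of_localLetters_haar`'s `(hBL : …)` binder VERBATIM (:170–185, `n := 2`) at the frames of record (`Sinf := {w ∕∕ IsComplex}`,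
`φ σ := σ.1.embedding`, `w := id`, `er := e₂ (n := 2)`), from: the (KW-fac)∕(x-a) column letters of record (`ht hk 𝒦' h𝒦' s₀ A hAlaw hfin hAc FinfT hread T₀ νinf`, as ★
`hex_of_dispatch`), the frames of record BY VALUE with ★ p863892's letters (`T Tinv hTdef hTinvdef A B hA hB M hM hT1 hTe hTe'`), the guarded reading `Finf∕hFinf`, and the
carrier uniformity `hν : ∀ T T', νinf T = νinf T'` (★ p864253 (3a′) `νinf_eq_of_factorisation`'s conclusion, BY VALUE — one name for the tie).  NOTHING ELSE: (L1) = ★ p864207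
(its own frames are identified with `T Tinv` through the SAME closed forms) ∘ ★ `heb_of_skew` ∘ the (3c) part 3 adapter; (L2) = ★ p864208 `hWgrU_of_record` ∘ ★ p864042
`hWhol_of_std` ∘ ★ §C `stabUniform_posDef∕negDef∕indef` (∘ ★ §B ∘ ★ 2b′∕2c′∕(R3)-G6 of record); (L3) = ★ p864255 inside ★ p864379; (iii-arch) conversion ★ p864165∕p864102.
[Shimura1982, §4 Thm. 4.2] [Shimura1997, §16.4, §18.4] [KudlaRallis1994, §1–§2] [Tan1999, §3] [BorelJacquet1979, §1.2, §4.1].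
HONEST LABEL.  Count-neutral helper; closes no socket by itself: `HC_CM` is proved only modulo the 7 printed citations (2 remaining named inputs:
hLiu418 = `stmt-HodgeConjecture-24832`, h413 = `stmt-HodgeConjecture-24833`) until rung 0 closes.

## References
* [Shimura1982] G. Shimura, *Confluent hypergeometric functions on tube domains*, Math. Ann. 260 (1982), §4 Thm. 4.2.
* [Shimura1997] G. Shimura, *Euler Products and Eisenstein Series*, CBMS 93 (1997), §16.4, §18.4.
* [KudlaRallis1994] S. Kudla, S. Rallis, Ann. of Math. 140 (1994), §1–§2.
* [Tan1999] V. Tan, *Poles of Siegel Eisenstein series on U(n,n)*, Canad. J. Math. 51 (1999), §3.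
* [BorelJacquet1979] A. Borel, H. Jacquet, Proc. Symp. Pure Math. 33 (1979), §1.2, §4.1.
-/

set_option autoImplicit false
set_option linter.dupNamespace false -- the mandated namespace repeats `HodgeConjecture.HodgeConjecture`

noncomputable section

open scoped Matrix ComplexConjugate Classical NNReal
open Complex Matrix MeasureTheory MeasureTheory.Measure NumberField NumberField.InfinitePlace IsDedekindDomain
open Literature.NumberTheory.ModularForms.SiegelUpperHalfSpace (moeb)
open Literature.NumberTheory.Automorphic Literature.NumberTheory.Automorphic.UnitaryGroup Literature.NumberTheory.GaloisRepresentations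
open Literature.NumberTheory.GelbartRogawski1991 Literature.NumberTheory.GelbartRogawski1991.GRConstruction
open Literature.NumberTheory.GelbartRogawski1991.UnitaryDualPair
open Literature.NumberTheory.K2Lit.SiegelDoubled

namespace Summit.HodgeConjecture.HodgeConjecture.Cruxes.HLiu418.K2LiuKindWArchBlockLetterOfRecord

open K2LiuU22CompactPictureDefs K2LiuArchInducedTubeDefs K2LiuSiegelUnipotentLocalDefs K2LiuArchSWSpanningDefs
open K2LiuSiegelUnipotentFourierDefs (skewMatrices unipDeltaChar)
open K2LiuSiegelEisensteinKindWLetters (kindWFinset)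
open K2LiuKindWArchLetterDefs (archWhittakerIntegral kindWArchLetter)
open K2LiuHolTubeRigidityOfFrame (frame_mem frame_mul frame_archPart_weylDelta)
open K2LiuKindWArchFramedIndexHermitian (framedIndex_det_ne_zero_of_frame framedIndex_conjTranspose_of_frame heb_of_skew)
open K2LiuKindWArchBlockLetterOfPlaceGrowth (hBL_of_placeGrowth)
open K2LiuKindWArchGrowthFaceOfRecord (hWgrU_of_record)
open K2LiuKindWArchGrowthStabUniformSigns (stabUniform_posDef stabUniform_negDef stabUniform_indef)
open K2LiuKindWArchWhittakerHolomorphy (hWhol_of_std)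
open K2LiuKindWArchContinuationExplicitOfRecord (exists_frames_archWhittakerIntegral_eq_of_std)

/-! ## §1 The (L1) chain adapter: ★ p864207's face-refined index `Σ j, Fin (m' j)` ⟶ one index type, constant carrier -/

/-- **generic (L1) adapter**: a chain identity with face-refined index `r : Fin (m' j)` and an `S,h`-dependent constant `CN S h = cν` gives the chain identity with ONE
index type `Σ j, Fin (m' j)`, coefficients `if i.1 = j then c' i.1 i.2 else 0` and the constant `cν`. [folklore] -/
theorem hchain_of_sigma {ιS ιh W P : Type*} [Fintype W] {m : ℕ} (m' : Fin m → ℕ) (good : ιS → Prop) (a : ℝ)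
    (Φ : W → P → ιS → ιh → ℂ → ℂ → Prop) (Q' : ∀ j : Fin m, Fin (m' j) → W → P)
    (AWI : Fin m → ιS → ιh → ℂ → ℂ) (Cst : ℂ → ℂ) (c' : ∀ j : Fin m, Fin (m' j) → ℂ) (CN : ιS → ιh → ℂ) (cν : ℝ)
    (hx : ∀ Ew' : (∀ j : Fin m, Fin (m' j) → ιS → ιh → W → ℂ → ℂ),
      (∀ (j : Fin m) (r : Fin (m' j)) (S : ιS) (h : ιh) (w : W), good S → ∀ s : ℂ, a < s.re → Φ w (Q' j r w) S h s (Ew' j r S h w s)) →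
      ∀ (j : Fin m) (S : ιS) (h : ιh), good S → ∀ s : ℂ, a < s.re → AWI j S h s = Cst s * ∑ r, c' j r * (CN S h * ∏ w, Ew' j r S h w s))
    (hν : ∀ S h, CN S h = (cν : ℂ)) :
    ∀ Ew : (Σ j : Fin m, Fin (m' j)) → ιS → ιh → W → ℂ → ℂ,
      (∀ (i : Σ j : Fin m, Fin (m' j)) (S : ιS) (h : ιh) (w : W), good S → ∀ s : ℂ, a < s.re → Φ w (Q' i.1 i.2 w) S h s (Ew i S h w s)) →
      ∀ (j : Fin m) (S : ιS) (h : ιh) (s : ℂ), good S → a < s.re →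
        AWI j S h s = Cst s * ∑ i : (Σ j : Fin m, Fin (m' j)), (if i.1 = j then c' i.1 i.2 else 0) * ((cν : ℂ) * ∏ w, Ew i S h w s) := by
  intro Ew hEw j S h s hS hs
  rw [hx (fun j r => Ew ⟨j, r⟩) (fun j r S h w hS s hs => hEw ⟨j, r⟩ S h w hS s hs) j S h hS s hs, hν S h]
  congr 1
  rw [Fintype.sum_sigma, Finset.sum_eq_single j (fun j' _ hj' => by simp [hj']) (fun hj => absurd (Finset.mem_univ j) hj)]
  simp only [if_true]

/-! ### §1b The record specialisation of the adapter -/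

section Record

variable (L : Type) [Field L] [NumberField L] [IsCMField L]
variable {N₀ M₀ : ℕ} (e : Fin N₀ × Fin M₀ ≃ Fin 2)
  (dV : Fin N₀ → L) (hdV : ∀ i, IsCMField.complexConj L (dV i) = dV i)
  (dW : Fin M₀ → L) (hdW : ∀ i, IsCMField.complexConj L (dW i) = dW i)
  [MeasurableSpace ↥(unipDeltaArch L e dV hdV dW hdW)]

/-- **THE (L1) CHAIN OF RECORD** for ★ p864379 `hBL_of_placeGrowth`: from ★ p864207's face-refined chain clause (BY VALUE as `hx`, after `eb := cexp(−2πi·tr(h_w(S)·b))`,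
weight `k`, abscissa `a`, scalar `Cst`) and the carrier uniformity `hν` (★ p864253), the `hchain` binder at `ιQ := Σ j, Fin (m' j)`, `Q w i := Q' i.1 i.2 w`,
`c j i := if i.1 = j then c' i.1 i.2 else 0`, `cν := cν' (νinf ∅)`, `s₁ := a`. [cite: Shimura1997, §18.4] [cite: KudlaRallis1994, §1–§2] [cite: Tan1999, §3] -/
theorem hchain_of_explicitOfRecord (T Tinv : {w : InfinitePlace L // w.IsComplex} → Matrix (Fin 2 ⊕ Fin 2) (Fin 2 ⊕ Fin 2) ℂ)
    (Fr : UnitaryGroup.arch (Fp L) L (IsCMField.complexConj L) (2 + 2) (hermD L e dV hdV dW hdW) → {w : InfinitePlace L // w.IsComplex} → Matrix (Fin 2 ⊕ Fin 2) (Fin 2 ⊕ Fin 2) ℂ)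
    (Bx Cx : {w : InfinitePlace L // w.IsComplex} → Matrix (Fin 2) (Fin 2) ℂ) (g : UnitaryGroup.arch (Fp L) L (IsCMField.complexConj L) (2 + 2) (hermD L e dV hdV dW hdW))
    (T₀ : Finset (HeightOneSpectrum (𝓞 (Fp L)))) (νinf : Finset (HeightOneSpectrum (𝓞 (Fp L))) → Measure ↥(unipDeltaArch L e dV hdV dW hdW)) {m : ℕ}
    (FinfT : Fin m → skewMatrices ((IsCMField.complexConj L : L ≃ₐ[Fp L] L) : L →+* L) ((gramR L e dV hdV dW hdW).map (algebraMap (Fp L) L)) →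
      HA L e dV hdV dW hdW → ℂ → UnitaryGroup.arch (Fp L) L (IsCMField.complexConj L) (2 + 2) (hermD L e dV hdV dW hdW) → ℂ)
    (k : {w : InfinitePlace L // w.IsComplex} → ℤ) (a : ℝ) (m' : Fin m → ℕ) (c' : ∀ j : Fin m, Fin (m' j) → ℂ)
    (Q' : ∀ j : Fin m, Fin (m' j) → {w : InfinitePlace L // w.IsComplex} → Carrier) (cν' : Measure ↥(unipDeltaArch L e dV hdV dW hdW) → ℝ≥0) (Cst : ℂ → ℂ)
    (hx : ∀ Ew : (∀ j : Fin m, Fin (m' j) → skewMatrices ((IsCMField.complexConj L : L ≃ₐ[Fp L] L) : L →+* L) ((gramR L e dV hdV dW hdW).map (algebraMap (Fp L) L)) →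
        HA L e dV hdV dW hdW → {w : InfinitePlace L // w.IsComplex} → ℂ → ℂ),
      (∀ (j : Fin m) (r : Fin (m' j)) (S : skewMatrices ((IsCMField.complexConj L : L ≃ₐ[Fp L] L) : L →+* L) ((gramR L e dV hdV dW hdW).map (algebraMap (Fp L) L)))
        (h : HA L e dV hdV dW hdW) (w : {w : InfinitePlace L // w.IsComplex}), (S : Matrix (Fin 2) (Fin 2) L).det ≠ 0 → ∀ s : ℂ, a < s.re →
        ∀ F : Matrix (Fin 2 ⊕ Fin 2) (Fin 2 ⊕ Fin 2) ℂ → ℂ, IsArchSiegelSection (fun z : ℂ => (conj z / ((‖z‖ : ℝ) : ℂ)) ^ (k w)) s F →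
          (∀ (v : Matrix (Fin 2) (Fin 2) ℂ), vᴴ * v = 1 → ∀ hv : v.det ≠ 0,
            F ((2 : ℂ)⁻¹ • fromBlocks (1 + v) (-(I • (1 - v))) (I • (1 - v)) (1 + v) : Matrix (Fin 2 ⊕ Fin 2) (Fin 2 ⊕ Fin 2) ℂ) = evalAt v hv (Q' j r w)) →
          ∫ x : Fin 2 → Fin 2 → ℝ, F ((fromBlocks 0 (Bx w) (Cx w) 0 : Matrix (Fin 2 ⊕ Fin 2) (Fin 2 ⊕ Fin 2) ℂ) * fromBlocks 1 (hermOfReal x) 0 1 *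
              Fr (UnitaryGroup.archPart (Fp L) L (IsCMField.complexConj L) (2 + 2) (hermD L e dV hdV dW hdW) h * g) w) *
            cexp (-(2 * Real.pi * I) * (((-2 : ℂ) • ((T w).toBlocks₂₂ * (S : Matrix (Fin 2) (Fin 2) L).map w.1.embedding * (Tinv w).toBlocks₁₁)) * hermOfReal x).trace) = Ew j r S h w s) →
      ∀ (j : Fin m) (S : skewMatrices ((IsCMField.complexConj L : L ≃ₐ[Fp L] L) : L →+* L) ((gramR L e dV hdV dW hdW).map (algebraMap (Fp L) L)))
        (h : HA L e dV hdV dW hdW), (S : Matrix (Fin 2) (Fin 2) L).det ≠ 0 → ∀ s : ℂ, a < s.re →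
        archWhittakerIntegral L e dV hdV dW hdW (νinf (kindWFinset L e dV hdV dW hdW T₀ (S : Matrix (Fin 2) (Fin 2) L) h)) (S : Matrix (Fin 2) (Fin 2) L)
            (FinfT j S h) (UnitaryGroup.archPart (Fp L) L (IsCMField.complexConj L) (2 + 2) (hermD L e dV hdV dW hdW) h) s =
          Cst s * ∑ r, c' j r * ((((cν' (νinf (kindWFinset L e dV hdV dW hdW T₀ (S : Matrix (Fin 2) (Fin 2) L) h))) : ℝ) : ℂ) * ∏ w, Ew j r S h w s))
    (hν : ∀ (S : skewMatrices ((IsCMField.complexConj L : L ≃ₐ[Fp L] L) : L →+* L) ((gramR L e dV hdV dW hdW).map (algebraMap (Fp L) L))) (h : HA L e dV hdV dW hdW),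
      νinf (kindWFinset L e dV hdV dW hdW T₀ (S : Matrix (Fin 2) (Fin 2) L) h) = νinf ∅) :
    ∀ Ew : (Σ j : Fin m, Fin (m' j)) → skewMatrices ((IsCMField.complexConj L : L ≃ₐ[Fp L] L) : L →+* L) ((gramR L e dV hdV dW hdW).map (algebraMap (Fp L) L)) →
        HA L e dV hdV dW hdW → {w : InfinitePlace L // w.IsComplex} → ℂ → ℂ,
      (∀ (i : Σ j : Fin m, Fin (m' j)) (S : skewMatrices ((IsCMField.complexConj L : L ≃ₐ[Fp L] L) : L →+* L) ((gramR L e dV hdV dW hdW).map (algebraMap (Fp L) L)))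
        (h : HA L e dV hdV dW hdW) (w : {w : InfinitePlace L // w.IsComplex}),
        (S : Matrix (Fin 2) (Fin 2) L).det ≠ 0 → ∀ s : ℂ, a < s.re →
        ∀ F : Matrix (Fin 2 ⊕ Fin 2) (Fin 2 ⊕ Fin 2) ℂ → ℂ, IsArchSiegelSection (fun z : ℂ => (conj z / ((‖z‖ : ℝ) : ℂ)) ^ (k w)) s F →
          (∀ (v : Matrix (Fin 2) (Fin 2) ℂ), vᴴ * v = 1 → ∀ hv : v.det ≠ 0,
            F ((2 : ℂ)⁻¹ • fromBlocks (1 + v) (-(I • (1 - v))) (I • (1 - v)) (1 + v) : Matrix (Fin 2 ⊕ Fin 2) (Fin 2 ⊕ Fin 2) ℂ) = evalAt v hv (Q' i.1 i.2 w)) →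
          ∫ x : Fin 2 → Fin 2 → ℝ, F ((fromBlocks 0 (Bx w) (Cx w) 0 : Matrix (Fin 2 ⊕ Fin 2) (Fin 2 ⊕ Fin 2) ℂ) * fromBlocks 1 (hermOfReal x) 0 1 *
              Fr (UnitaryGroup.archPart (Fp L) L (IsCMField.complexConj L) (2 + 2) (hermD L e dV hdV dW hdW) h * g) w) *
            cexp (-(2 * Real.pi * I) * (((-2 : ℂ) • ((T w).toBlocks₂₂ * (S : Matrix (Fin 2) (Fin 2) L).map w.1.embedding * (Tinv w).toBlocks₁₁)) * hermOfReal x).trace) = Ew i S h w s) →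
      ∀ (j : Fin m) (S : skewMatrices ((IsCMField.complexConj L : L ≃ₐ[Fp L] L) : L →+* L) ((gramR L e dV hdV dW hdW).map (algebraMap (Fp L) L))) (h : HA L e dV hdV dW hdW) (s : ℂ),
        (S : Matrix (Fin 2) (Fin 2) L).det ≠ 0 → a < s.re →
        archWhittakerIntegral L e dV hdV dW hdW (νinf (kindWFinset L e dV hdV dW hdW T₀ (S : Matrix (Fin 2) (Fin 2) L) h)) (S : Matrix (Fin 2) (Fin 2) L)
          (FinfT j S h) (UnitaryGroup.archPart (Fp L) L (IsCMField.complexConj L) (2 + 2) (hermD L e dV hdV dW hdW) h) s =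
        Cst s * ∑ i, (if i.1 = j then c' i.1 i.2 else 0) * ((((cν' (νinf ∅) : ℝ≥0) : ℝ) : ℂ) * ∏ w, Ew i S h w s) :=
  hchain_of_sigma (ιS := skewMatrices ((IsCMField.complexConj L : L ≃ₐ[Fp L] L) : L →+* L) ((gramR L e dV hdV dW hdW).map (algebraMap (Fp L) L)))
    (ιh := HA L e dV hdV dW hdW) (W := {w : InfinitePlace L // w.IsComplex}) (P := Carrier) m' (fun S => (S : Matrix (Fin 2) (Fin 2) L).det ≠ 0) a
    (fun w Qp S h s v => ∀ F : Matrix (Fin 2 ⊕ Fin 2) (Fin 2 ⊕ Fin 2) ℂ → ℂ, IsArchSiegelSection (fun z : ℂ => (conj z / ((‖z‖ : ℝ) : ℂ)) ^ (k w)) s F →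
      (∀ (u : Matrix (Fin 2) (Fin 2) ℂ), uᴴ * u = 1 → ∀ hu : u.det ≠ 0,
        F ((2 : ℂ)⁻¹ • fromBlocks (1 + u) (-(I • (1 - u))) (I • (1 - u)) (1 + u) : Matrix (Fin 2 ⊕ Fin 2) (Fin 2 ⊕ Fin 2) ℂ) = evalAt u hu Qp) →
      ∫ x : Fin 2 → Fin 2 → ℝ, F ((fromBlocks 0 (Bx w) (Cx w) 0 : Matrix (Fin 2 ⊕ Fin 2) (Fin 2 ⊕ Fin 2) ℂ) * fromBlocks 1 (hermOfReal x) 0 1 *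
          Fr (UnitaryGroup.archPart (Fp L) L (IsCMField.complexConj L) (2 + 2) (hermD L e dV hdV dW hdW) h * g) w) *
        cexp (-(2 * Real.pi * I) * (((-2 : ℂ) • ((T w).toBlocks₂₂ * (S : Matrix (Fin 2) (Fin 2) L).map w.1.embedding * (Tinv w).toBlocks₁₁)) * hermOfReal x).trace) = v)
    Q' (fun j S h s => archWhittakerIntegral L e dV hdV dW hdW (νinf (kindWFinset L e dV hdV dW hdW T₀ (S : Matrix (Fin 2) (Fin 2) L) h)) (S : Matrix (Fin 2) (Fin 2) L)
      (FinfT j S h) (UnitaryGroup.archPart (Fp L) L (IsCMField.complexConj L) (2 + 2) (hermD L e dV hdV dW hdW) h) s)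
    Cst c' (fun S h => ((((cν' (νinf (kindWFinset L e dV hdV dW hdW T₀ (S : Matrix (Fin 2) (Fin 2) L) h))) : ℝ) : ℂ))) ((cν' (νinf ∅) : ℝ≥0) : ℝ) hx
    (fun S h => by rw [hν S h])

end Record

/-! ## §2 THE HEAD OF RECORD -/

section Head

variable (L : Type) [Field L] [NumberField L] [IsCMField L]
variable {N₀ M₀ : ℕ} (e : Fin N₀ × Fin M₀ ≃ Fin 2)
  (dV : Fin N₀ → L) (hdV : ∀ i, IsCMField.complexConj L (dV i) = dV i)
  (dW : Fin M₀ → L) (hdW : ∀ i, IsCMField.complexConj L (dW i) = dW i)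
  [MeasurableSpace ↥(unipDeltaArch L e dV hdV dW hdW)] [BorelSpace ↥(unipDeltaArch L e dV hdV dW hdW)]

/-- **THE (iii-arch) BLOCK LETTER `hBL` OF RECORD, ZERO RESIDUE** (★ p863724 :170–185 VERBATIM at `n := 2`, `Sinf := {w ∕∕ IsComplex}`, `φ σ := σ.1.embedding`, `w := id`, `er := e₂`).
Inputs: the (KW-fac)∕(x-a) letters of record, the frames of record by value (★ p863892's letters), the guarded reading, the carrier uniformity `hν` (★ p864253).
[cite: Shimura1982, §4 Thm. 4.2] [cite: Shimura1997, §16.4, §18.4] [cite: KudlaRallis1994, §1–§2] [cite: Tan1999, §3] [cite: BorelJacquet1979, §1.2, §4.1] -/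
theorem hBL_of_record (hdV0 : ∀ i, dV i ≠ 0) (hdW0 : ∀ i, dW i ≠ 0)
    -- the (KW-fac)∕(x-a) column letters of record (as ★ `hex_of_dispatch` ∕ ★ p864207)
    {χ : HeckeCharacter L} {t : InfinitePlace L → ℤ} (ht : χ.HasUnitaryArchType t 0) (hk : ∀ w : {w : InfinitePlace L // w.IsComplex}, (-2 : ℤ) ≤ -(t w.1))
    (𝒦' : IwasawaDatum L e dV hdV dW hdW) (h𝒦' : 𝒦'.IsStd) (s₀ : ℂ) {m : ℕ}
    (Asl : Fin m → UnitaryGroup.arch (Fp L) L (IsCMField.complexConj L) (2 + 2) (hermD L e dV hdV dW hdW) → ℂ)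
    (hAlaw : ∀ j, ∀ p : HA L e dV hdV dW hdW, IsSiegelDelta L e dV hdV dW hdW p → UnitaryGroup.finPart (Fp L) L (IsCMField.complexConj L) (2 + 2) (hermD L e dV hdV dW hdW) p = 1 →
      ∀ x : UnitaryGroup.arch (Fp L) L (IsCMField.complexConj L) (2 + 2) (hermD L e dV hdV dW hdW),
        Asl j (UnitaryGroup.archPart (Fp L) L (IsCMField.complexConj L) (2 + 2) (hermD L e dV hdV dW hdW) p * x) = siegelDeltaCharacter L e dV hdV dW hdW χ s₀ p * Asl j x)
    (hfin : ∀ j, ∃ V : Submodule ℂ (UnitaryGroup.arch (Fp L) L (IsCMField.complexConj L) (2 + 2) (hermD L e dV hdV dW hdW) → ℂ), FiniteDimensional ℂ V ∧ Asl j ∈ V ∧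
      ∀ a₀ : UnitaryGroup.arch (Fp L) L (IsCMField.complexConj L) (2 + 2) (hermD L e dV hdV dW hdW),
        (UnitaryGroup.archToAdelic (Fp L) L (IsCMField.complexConj L) (2 + 2) (hermD L e dV hdV dW hdW) a₀ : HA L e dV hdV dW hdW) ∈ 𝒦'.K → ∀ G ∈ V, (fun x => G (x * a₀)) ∈ V)
    (hAc : ∀ j, Continuous (Asl j))
    (FinfT : Fin m → skewMatrices ((IsCMField.complexConj L : L ≃ₐ[Fp L] L) : L →+* L) ((gramR L e dV hdV dW hdW).map (algebraMap (Fp L) L)) → HA L e dV hdV dW hdW → ℂ → UnitaryGroup.arch (Fp L) L (IsCMField.complexConj L) (2 + 2) (hermD L e dV hdV dW hdW) → ℂ)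
    (hread : ∀ (S : skewMatrices ((IsCMField.complexConj L : L ≃ₐ[Fp L] L) : L →+* L) ((gramR L e dV hdV dW hdW).map (algebraMap (Fp L) L))) (h : HA L e dV hdV dW hdW) (s : ℂ) (j : Fin m) (a : UnitaryGroup.arch (Fp L) L (IsCMField.complexConj L) (2 + 2) (hermD L e dV hdV dW hdW)),
      FinfT j S h s a =
        (((modDelta L e dV hdV dW hdW (𝒦'.pPart (UnitaryGroup.archToAdelic (Fp L) L (IsCMField.complexConj L) (2 + 2) (hermD L e dV hdV dW hdW) a)) : ℝ) : ℂ) ^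
            (2 * (s - s₀))) * Asl j a)
    (T₀ : Finset (HeightOneSpectrum (𝓞 (Fp L))))
    (νinf : Finset (HeightOneSpectrum (𝓞 (Fp L))) → Measure ↥(unipDeltaArch L e dV hdV dW hdW)) [∀ T' : Finset (HeightOneSpectrum (𝓞 (Fp L))), (νinf T').IsHaarMeasure]
    -- the carrier uniformity (★ p864253 (3a′), by value)
    (hν : ∀ T T' : Finset (HeightOneSpectrum (𝓞 (Fp L))), νinf T = νinf T')
    -- the frames of record BY VALUE (★ p863892's letters)
    (T Tinv : {w : InfinitePlace L // w.IsComplex} → Matrix (Fin 2 ⊕ Fin 2) (Fin 2 ⊕ Fin 2) ℂ)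
    (hTdef : ∀ w, T w = fromBlocks (diagonal (fun k => (Real.sqrt (|(w.1.embedding (dV (e.symm k).1 * dW (e.symm k).2)).re| / 2) : ℂ))) (diagonal (fun k => (Real.sqrt (|(w.1.embedding (dV (e.symm k).1 * dW (e.symm k).2)).re| / 2) : ℂ)))
      (diagonal (fun k => I * ((((w.1.embedding (dV (e.symm k).1 * dW (e.symm k).2)).re / |(w.1.embedding (dV (e.symm k).1 * dW (e.symm k).2)).re|) * Real.sqrt (|(w.1.embedding (dV (e.symm k).1 * dW (e.symm k).2)).re| / 2) : ℝ) : ℂ))) (-diagonal (fun k => I * ((((w.1.embedding (dV (e.symm k).1 * dW (e.symm k).2)).re / |(w.1.embedding (dV (e.symm k).1 * dW (e.symm k).2)).re|) * Real.sqrt (|(w.1.embedding (dV (e.symm k).1 * dW (e.symm k).2)).re| / 2) : ℝ) : ℂ))))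
    (hTinvdef : ∀ w, Tinv w = fromBlocks (diagonal (fun k => (((Real.sqrt (|(w.1.embedding (dV (e.symm k).1 * dW (e.symm k).2)).re| / 2))⁻¹ / 2 : ℝ) : ℂ))) (-diagonal (fun k => I * (((Real.sqrt (|(w.1.embedding (dV (e.symm k).1 * dW (e.symm k).2)).re| / 2))⁻¹ * ((w.1.embedding (dV (e.symm k).1 * dW (e.symm k).2)).re / |(w.1.embedding (dV (e.symm k).1 * dW (e.symm k).2)).re|) / 2 : ℝ) : ℂ)))
      (diagonal (fun k => (((Real.sqrt (|(w.1.embedding (dV (e.symm k).1 * dW (e.symm k).2)).re| / 2))⁻¹ / 2 : ℝ) : ℂ))) (diagonal (fun k => I * (((Real.sqrt (|(w.1.embedding (dV (e.symm k).1 * dW (e.symm k).2)).re| / 2))⁻¹ * ((w.1.embedding (dV (e.symm k).1 * dW (e.symm k).2)).re / |(w.1.embedding (dV (e.symm k).1 * dW (e.symm k).2)).re|) / 2 : ℝ) : ℂ))))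
    (A B : {w : InfinitePlace L // w.IsComplex} → Matrix (Fin 2) (Fin 2) ℂ) (hA : ∀ σ, A σ = (-2 : ℂ) • (T σ).toBlocks₂₂) (hB : ∀ σ, B σ = (Tinv σ).toBlocks₁₁)
    {M : ℝ} (hM : 1 ≤ M) (hT1 : ∀ σ, T σ * Tinv σ = 1) (hTe : ∀ σ i j, ‖T σ i j‖ ≤ M) (hTe' : ∀ σ i j, ‖Tinv σ i j‖ ≤ M)
    -- the guarded reading of the block-diagonal factors
    (Finf : Fin m → skewMatrices ((IsCMField.complexConj L : L ≃ₐ[Fp L] L) : L →+* L) ((gramR L e dV hdV dW hdW).map (algebraMap (Fp L) L)) → ℂ → HA L e dV hdV dW hdW → ℂ)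
    (hFinf : ∀ j S s h, Finf j S s h = if (S : Matrix (Fin 2) (Fin 2) L).det = 0 then 0 else kindWArchLetter L e dV hdV dW hdW νinf T₀ FinfT j S s h) :
    ∀ z : ℂ, 0 < z.re → ∃ (cg Ng N'g Kt C a r : ℝ), 0 < cg ∧ 0 ≤ Ng ∧ 0 ≤ N'g ∧ 1 ≤ Kt ∧ 0 ≤ C ∧ 0 ≤ a ∧ 0 < r ∧
      ∀ (j : Fin m) (S : skewMatrices ((IsCMField.complexConj L : L ≃ₐ[Fp L] L) : L →+* L) ((gramR L e dV hdV dW hdW).map (algebraMap (Fp L) L))) (s : ℂ),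
      dist s z < r → (S : Matrix (Fin 2) (Fin 2) L).det ≠ 0 →
      ∀ (h : HA L e dV hdV dW hdW) (y b d : {w : InfinitePlace L // w.IsComplex} → Matrix (Fin 2) (Fin 2) ℂ) (κ κ' : {w : InfinitePlace L // w.IsComplex} → Matrix (Fin 2 ⊕ Fin 2) (Fin 2 ⊕ Fin 2) ℂ),
      (∀ σ, κ σ * κ' σ = 1) → (∀ σ, κ' σ * κ σ = 1) → (∀ σ i j, ‖κ σ i j‖ ≤ M) → (∀ σ i j, ‖κ' σ i j‖ ≤ M) →
      (∀ σ, T σ * Matrix.reindex (e₂ (n := 2)).symm (e₂ (n := 2)).symm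
          (((UnitaryGroup.archAt (Fp L) L (IsCMField.complexConj L) (2 + 2) (hermD L e dV hdV dW hdW) σ
              (UnitaryGroup.complexConj_smul_infinitePlace L σ.1) (IsCMField.complexConj_ne_one L)
              (UnitaryGroup.archPart (Fp L) L (IsCMField.complexConj L) (2 + 2) (hermD L e dV hdV dW hdW) h) :
                UnitaryGroup.archLocal L (2 + 2) (hermD L e dV hdV dW hdW) σ) : GL (Fin (2 + 2)) ℂ) : Matrix (Fin (2 + 2)) (Fin (2 + 2)) ℂ) * Tinv σ =
        Matrix.fromBlocks (y σ) (b σ) 0 (d σ) * κ σ) →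
      ∃ t : {w : InfinitePlace L // w.IsComplex} → ℝ,
        (∀ σ a b, ‖((y σ)ᴴ * (A σ * ((S : Matrix (Fin 2) (Fin 2) L).map σ.1.embedding) * B σ) * y σ) a b‖ ≤ t σ) ∧
        (∀ σ, t σ ≤ Kt * ∑ a, ∑ b, ‖((y σ)ᴴ * (A σ * ((S : Matrix (Fin 2) (Fin 2) L).map σ.1.embedding) * B σ) * y σ) a b‖) ∧
        ‖Finf j S s h‖ ≤ C * adelicHeightGL (2 + 2) L (h : GL (Fin (2 + 2)) (AdeleRing (𝓞 L) L)) ^ a *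
          ∏ σ, (Real.exp (-(cg * t σ)) * (1 + t σ) ^ Ng *
            (1 + ‖((y σ)ᴴ * (A σ * ((S : Matrix (Fin 2) (Fin 2) L).map σ.1.embedding) * B σ) * y σ).det‖ ^ (-N'g))) := by
  -- ★ p864207: the explicit (x-a) chain WITH ITS OWN frames of record; identify them with the by-value `T Tinv` through the closed forms
  obtain ⟨T', Tinv', Fr, Bx, Cx, g, m', c', Q', cν', hTdef', hTinvdef', hFr, hT1', hT2, hTU, -, hTN, -, -, hW, hCu, -, h207⟩ :=
    exists_frames_archWhittakerIntegral_eq_of_std L e dV hdV dW hdW hdV0 hdW0 ht 𝒦' h𝒦' s₀ Asl hAlaw hfin hAc FinfT hread T₀ νinf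
  have hTT : T' = T := funext fun w => by rw [hTdef' w, hTdef w]
  have hTiT : Tinv' = Tinv := funext fun w => by rw [hTinvdef' w, hTinvdef w]
  subst T'
  subst Tinv'
  -- the anti-diagonal base point `(0 Bx; Cx 0) = Fr (w_Δ)_∞ ∈ U(J)` (★ `frame_archPart_weylDelta`, ★ `frame_mem`)
  have hx : ∀ w, (fromBlocks 0 (Bx w) (Cx w) 0 : Matrix (Fin 2 ⊕ Fin 2) (Fin 2 ⊕ Fin 2) ℂ)ᴴ * Matrix.J (Fin 2) ℂ *
      (fromBlocks 0 (Bx w) (Cx w) 0 : Matrix (Fin 2 ⊕ Fin 2) (Fin 2 ⊕ Fin 2) ℂ) = Matrix.J (Fin 2) ℂ := fun w => by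
    rw [← hW w, ← frame_archPart_weylDelta L e dV hdV dW hdW T Tinv Fr hFr w]
    exact frame_mem L e dV hdV dW hdW T Tinv Fr hFr hTU _ w
  have hPt : ∀ (S : skewMatrices ((IsCMField.complexConj L : L ≃ₐ[Fp L] L) : L →+* L) ((gramR L e dV hdV dW hdW).map (algebraMap (Fp L) L))) (h : HA L e dV hdV dW hdW)
      (w : {w : InfinitePlace L // w.IsComplex}),
      (Fr (UnitaryGroup.archPart (Fp L) L (IsCMField.complexConj L) (2 + 2) (hermD L e dV hdV dW hdW) h * g) w)ᴴ * Matrix.J (Fin 2) ℂ *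
        Fr (UnitaryGroup.archPart (Fp L) L (IsCMField.complexConj L) (2 + 2) (hermD L e dV hdV dW hdW) h * g) w = Matrix.J (Fin 2) ℂ := fun S h w =>
    frame_mem L e dV hdV dW hdW T Tinv Fr hFr hTU _ w
  have hherm : ∀ (S : skewMatrices ((IsCMField.complexConj L : L ≃ₐ[Fp L] L) : L →+* L) ((gramR L e dV hdV dW hdW).map (algebraMap (Fp L) L))) (w : {w : InfinitePlace L // w.IsComplex}),
      ((-2 : ℂ) • ((T w).toBlocks₂₂ * (S : Matrix (Fin 2) (Fin 2) L).map w.1.embedding * (Tinv w).toBlocks₁₁))ᴴ =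
        (-2 : ℂ) • ((T w).toBlocks₂₂ * (S : Matrix (Fin 2) (Fin 2) L).map w.1.embedding * (Tinv w).toBlocks₁₁) := fun S w =>
    framedIndex_conjTranspose_of_frame L e dV hdV dW hdW T Tinv hTdef hTinvdef hdV0 hdW0 (S : Matrix (Fin 2) (Fin 2) L) S.2 w
  -- (L1) the chain of record: ★ p864207's clause at the record character (`heb` = ★ `heb_of_skew`), re-indexed by §1, carrier constant by `hν`
  have hchain := hchain_of_explicitOfRecord L e dV hdV dW hdW T Tinv Fr Bx Cx g T₀ νinf FinfT (fun w => -(t w.1)) (((2 : ℕ) : ℝ) / 2) m' c' Q' cν'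
    (fun s => (((modDelta L e dV hdV dW hdW (𝒦'.pPart (UnitaryGroup.archToAdelic (Fp L) L (IsCMField.complexConj L) (2 + 2) (hermD L e dV hdV dW hdW) g⁻¹)) : ℝ) : ℂ) ^
      (2 * (s - s₀))))
    (h207 (fun (S : skewMatrices ((IsCMField.complexConj L : L ≃ₐ[Fp L] L) : L →+* L) ((gramR L e dV hdV dW hdW).map (algebraMap (Fp L) L))) (_ : HA L e dV hdV dW hdW)
          (w : {w : InfinitePlace L // w.IsComplex}) (b : Matrix (Fin 2) (Fin 2) ℂ) =>
        cexp (-(2 * Real.pi * I) * (((-2 : ℂ) • ((T w).toBlocks₂₂ * (S : Matrix (Fin 2) (Fin 2) L).map w.1.embedding * (Tinv w).toBlocks₁₁)) * b).trace))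
      (fun S _ u => heb_of_skew L e dV hdV dW hdW T Tinv Fr hFr hT2 hTN hTdef hTinvdef hdV0 hdW0 S u)) (fun S h => hν _ _)
  -- (L2) the uniform per-place growth: ★ p864208 ∘ ★ p864042 `hWhol_of_std` ∘ ★ §C (the three signs, ALL by name)
  have hWgrU := hWgrU_of_record
    (fun S : skewMatrices ((IsCMField.complexConj L : L ≃ₐ[Fp L] L) : L →+* L) ((gramR L e dV hdV dW hdW).map (algebraMap (Fp L) L)) => (S : Matrix (Fin 2) (Fin 2) L).det ≠ 0)
    (fun w : {w : InfinitePlace L // w.IsComplex} => -(t w.1)) Bx Cx hx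
    (fun (S : skewMatrices ((IsCMField.complexConj L : L ≃ₐ[Fp L] L) : L →+* L) ((gramR L e dV hdV dW hdW).map (algebraMap (Fp L) L))) (h : HA L e dV hdV dW hdW)
        (w : {w : InfinitePlace L // w.IsComplex}) => Fr (UnitaryGroup.archPart (Fp L) L (IsCMField.complexConj L) (2 + 2) (hermD L e dV hdV dW hdW) h * g) w)
    hPt
    (fun (S : skewMatrices ((IsCMField.complexConj L : L ≃ₐ[Fp L] L) : L →+* L) ((gramR L e dV hdV dW hdW).map (algebraMap (Fp L) L))) (_ : HA L e dV hdV dW hdW)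
        (w : {w : InfinitePlace L // w.IsComplex}) (b : Matrix (Fin 2) (Fin 2) ℂ) =>
      cexp (-(2 * Real.pi * I) * (((-2 : ℂ) • ((T w).toBlocks₂₂ * (S : Matrix (Fin 2) (Fin 2) L).map w.1.embedding * (Tinv w).toBlocks₁₁)) * b).trace))
    (fun (S : skewMatrices ((IsCMField.complexConj L : L ≃ₐ[Fp L] L) : L →+* L) ((gramR L e dV hdV dW hdW).map (algebraMap (Fp L) L))) (_ : HA L e dV hdV dW hdW)
        (w : {w : InfinitePlace L // w.IsComplex}) => (-2 : ℂ) • ((T w).toBlocks₂₂ * (S : Matrix (Fin 2) (Fin 2) L).map w.1.embedding * (Tinv w).toBlocks₁₁))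
    (fun S _ w => hherm S w)
    (fun S hS _ w => framedIndex_det_ne_zero_of_frame L e dV hdV dW hdW T Tinv hTdef hTinvdef hdV0 hdW0 (S : Matrix (Fin 2) (Fin 2) L) hS w)
    (fun (w : {w : InfinitePlace L // w.IsComplex}) (i : Σ j : Fin m, Fin (m' j)) => Q' i.1 i.2 w) (((2 : ℕ) : ℝ) / 2) (by norm_num)
    (hWhol_of_std
      (fun S : skewMatrices ((IsCMField.complexConj L : L ≃ₐ[Fp L] L) : L →+* L) ((gramR L e dV hdV dW hdW).map (algebraMap (Fp L) L)) => (S : Matrix (Fin 2) (Fin 2) L).det ≠ 0)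
      (fun w : {w : InfinitePlace L // w.IsComplex} => -(t w.1)) Bx Cx hx _ hPt _ _ (fun S _ w => hherm S w) (fun _ _ _ _ => rfl) (((2 : ℕ) : ℝ) / 2) (by norm_num))
    (fun z hz w i => by
      obtain ⟨Cg, cg, N, N', r, h0, h1, h2, h3, h4, hm⟩ := stabUniform_posDef (hk w) (Q' i.1 i.2 w) (hx w) z hz
      exact ⟨Cg, cg, N, N', r, h0, h1, h2, h3, h4, fun S _ h hsg => hm _ hsg _ (fun _ => rfl) _ (hPt S h w)⟩)
    (fun z hz w i => by
      obtain ⟨Cg, cg, N, N', r, h0, h1, h2, h3, h4, hm⟩ := stabUniform_negDef (hk w) (Q' i.1 i.2 w) (hx w) z hz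
      exact ⟨Cg, cg, N, N', r, h0, h1, h2, h3, h4, fun S _ h hsg => hm _ hsg _ (fun _ => rfl) _ (hPt S h w)⟩)
    (fun z hz w i => by
      obtain ⟨Cg, cg, N, N', r, h0, h1, h2, h3, h4, hm⟩ := stabUniform_indef (hk w) (Q' i.1 i.2 w) (hx w) z hz
      exact ⟨Cg, cg, N, N', r, h0, h1, h2, h3, h4, fun S _ h hsg => hm _ ⟨hherm S w, hsg⟩ _ (fun _ => rfl) _ (hPt S h w)⟩)
  -- ★ p864379: the (iii-arch) `hBL` assembler at `ιQ := Σ j, Fin (m' j)`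
  exact hBL_of_placeGrowth (M := M) (m := m) L e dV hdV dW hdW hdV0 hdW0 T Tinv hTdef hTinvdef Fr hFr hT2 hTU Bx Cx hx hCu g A B hA hB hM hT1 hTe hTe' T₀ νinf FinfT
    Finf hFinf (fun (w : {w : InfinitePlace L // w.IsComplex}) (i : Σ j : Fin m, Fin (m' j)) => Q' i.1 i.2 w) (fun w => -(t w.1)) (((2 : ℕ) : ℝ) / 2) (by norm_num)
    (fun j i => if i.1 = j then c' i.1 i.2 else 0) ((cν' (νinf ∅) : ℝ≥0) : ℝ)
    (fun s => (((modDelta L e dV hdV dW hdW (𝒦'.pPart (UnitaryGroup.archToAdelic (Fp L) L (IsCMField.complexConj L) (2 + 2) (hermD L e dV hdV dW hdW) g⁻¹)) : ℝ) : ℂ) ^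
      (2 * (s - s₀))))
    ((modDelta L e dV hdV dW hdW (𝒦'.pPart (UnitaryGroup.archToAdelic (Fp L) L (IsCMField.complexConj L) (2 + 2) (hermD L e dV hdV dW hdW) g⁻¹)) : ℝ))
    (by exact_mod_cast modDelta_pos L e dV hdV dW hdW _) s₀ (fun _ => rfl) hchain hWgrU

end Head

end Summit.HodgeConjecture.HodgeConjecture.Cruxes.HLiu418.K2LiuKindWArchBlockLetterOfRecord

end
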